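import Literature.AlgebraicGeometry.Motives.HodgeLieWeightOneRankTenSymplectic
import Literature.AlgebraicGeometry.Motives.HodgeThetaAnnihilatorTimesNonCMCurve
import HarnessLib

/-!
# The Θ-subalgebra theorem in `𝔰𝔭₁₀` with `End_Hdg = ℚ`: every admissible `𝔤` is `𝔰𝔭(V, ψ)`
# (Moonen–Zarhin 1999 (2.3)/(3.1); Deligne's minimality, LNM 900 I Prop. 3.4)

Topic `Literature/AlgebraicGeometry/Motives` (namespace `Literature.AlgebraicGeometry.Motives.HodgeStructure`).  Theorems only
(no definition, no named fact; D-0026).  Sequel of `HodgeLieWeightOneRankTenSymplectic` (`Lie Hg ⊗ ℂ = 𝔰𝔭₁₀`), written for the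
cell `pub-hodge-ring2` (literature lane gen 67, programme R44 step F4b; honest framing of that cell: research route conditional on
HC_CM; not a corollary; Q11.4-sentence-2 already refuted in dim ≥ 3 — this file is unconditional).  It is the rank-TEN analogue
of `SymplecticThetaSix.mem_spanC_of_skew` (`HodgeThetaSubalgebraSymplecticRankSixHodge`), with the same signature, so that the
rank-six §3 (`wordDerAt_eq_zero_of_skew`) and the `AVSlots` assembly of `GenericAbelianThreefoldPowersHodgeClasses` port verbatim.

* `spanC_inf_eq` — `(𝔞 ∩ 𝔟)_ℂ = 𝔞_ℂ ∩ 𝔟_ℂ` for rational subspaces of `End_ℚ(V)` (dimension count: `dim_ℂ 𝔞_ℂ = dim_ℚ 𝔞`).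
* **`SymplecticThetaTen.mem_spanC_of_skew`** — `H` effective polarized of weight `1`, `dim V = 10`, `End_Hdg = ℚ`; `𝔤 ⊆ 𝔰𝔭(V, ψ)`
  a rational bracket-closed subspace with `Θ ∈ 𝔤_ℂ`: every `ψ_ℂ`-skew operator lies in `𝔤_ℂ`.  PROOF: `𝔞 = 𝔤 ∩ Lie Hg` is
  bracket-closed with `Θ ∈ 𝔞_ℂ = 𝔤_ℂ ∩ (Lie Hg)_ℂ`; rigidity (`hodgeLie_rigid`) gives `Lie Hg ≤ 𝔞 ≤ 𝔤`, and
  `(Lie Hg)_ℂ = 𝔰𝔭₁₀` (`mem_hodgeLieC_of_skew_rankTen`).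

## References

* [MoonenZarhin1999LowDim] B. Moonen, Yu. Zarhin, *Hodge classes on abelian varieties of low dimension* (1999), §2 (2.3), §3 (3.1).
* [Deligne1982HodgeCycles] P. Deligne, *Hodge cycles on abelian varieties*, LNM 900 (1982), I §3 Prop. 3.4, 3.6.
-/

open scoped TensorProduct

namespace Literature.AlgebraicGeometry.Motives

open Module

universe u

variable {V : Type u} [AddCommGroup V] [Module ℚ V] [Module.Finite ℚ V] [HodgeTensorFacts.{u, u}] {n : ℤ}

namespace HodgeStructure

omit [HodgeTensorFacts.{u, u}] in
/-- **`(𝔞 ∩ 𝔟)_ℂ = 𝔞_ℂ ∩ 𝔟_ℂ`** for rational subspaces of `End_ℚ(V)`: `⊆` is monotonicity; the dimensions agree because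
`dim_ℂ 𝔠_ℂ = dim_ℚ 𝔠` (`finrank_spanC_eq`) and `(𝔞 + 𝔟)_ℂ = 𝔞_ℂ + 𝔟_ℂ` (`spanC_sup_le`), by the dimension formula for `⊔`/`⊓`.
[cite: Deligne1982HodgeCycles, I §3 (proof of Prop. 3.4: rational structures and base change)] -/
theorem spanC_inf_eq (𝔞 𝔟 : Submodule ℚ (Module.End ℚ V)) : spanC (𝔞 ⊓ 𝔟) = spanC 𝔞 ⊓ spanC 𝔟 := by
  have hle : spanC (𝔞 ⊓ 𝔟) ≤ spanC 𝔞 ⊓ spanC 𝔟 := le_inf (spanC_mono inf_le_left) (spanC_mono inf_le_right)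
  refine Submodule.eq_of_le_of_finrank_le hle ?_
  have hsup : spanC 𝔞 ⊔ spanC 𝔟 = spanC (𝔞 ⊔ 𝔟) :=
    le_antisymm (sup_le (spanC_mono le_sup_left) (spanC_mono le_sup_right)) (spanC_sup_le 𝔞 𝔟)
  have h1 := Submodule.finrank_sup_add_finrank_inf_eq (spanC 𝔞) (spanC 𝔟)
  have h2 := Submodule.finrank_sup_add_finrank_inf_eq 𝔞 𝔟
  rw [hsup, finrank_spanC_eq, finrank_spanC_eq, finrank_spanC_eq] at h1
  rw [finrank_spanC_eq]
  omega

/-- **Theorem (`𝔤_ℂ = 𝔰𝔭(V, ψ)_ℂ` for a weight-one Hodge structure of rank TEN with `End_Hdg = ℚ`; the Lie step of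
`Hg(X) = Sp₁₀` for simple abelian fivefolds with `End⁰(X) = ℚ`).**  Same signature as `SymplecticThetaSix.mem_spanC_of_skew`
with `6 ↦ 10`: for `𝔤 ⊆ 𝔰𝔭(V, ψ)` rational, bracket-closed, with `Θ ∈ 𝔤_ℂ`, every `ψ_ℂ`-skew operator of `V_ℂ` lies in `𝔤_ℂ`.
PROOF: `𝔞 := 𝔤 ∩ Lie Hg(H)` is bracket-closed and `Θ ∈ 𝔞_ℂ` (`spanC_inf_eq`, `mem_hodgeLieC_of_forall_piece`); Deligne's rigidity
(`hodgeLie_rigid`) gives `Lie Hg ≤ 𝔞 ≤ 𝔤`; and `(Lie Hg)_ℂ` contains every skew operator (`mem_hodgeLieC_of_skew_rankTen`).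
[cite: MoonenZarhin1999LowDim, §2 (2.3) and §3 (3.1)] [cite: Deligne1982HodgeCycles, I §3 Prop. 3.4] -/
theorem SymplecticThetaTen.mem_spanC_of_skew (H : HodgeStructure V n) (hn : n = 1) (heff : H.IsEffective)
    (ψ : H.Polarization) (hE : ∀ a ∈ H.endAlg, ∃ x : ℚ, a = x • (1 : Module.End ℚ V)) (hV : Module.finrank ℚ V = 10)
    (𝔤 : Submodule ℚ (Module.End ℚ V)) (hbr : ∀ X ∈ 𝔤, ∀ X' ∈ 𝔤, X * X' - X' * X ∈ 𝔤)
    {Θ : Module.End ℂ (ℂ ⊗[ℚ] V)} (hΘ : ∀ p, ∀ x ∈ H.piece p (n - p), Θ x = ((2 * p - n : ℤ) : ℂ) • x)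
    (hΘ𝔤 : Θ ∈ spanC 𝔤) (_hskew : ∀ X ∈ 𝔤, ∀ v w, ψ.form (X v) w + ψ.form v (X w) = 0)
    {Y : Module.End ℂ (ℂ ⊗[ℚ] V)} (hY : ∀ x y, ψ.form.baseChange ℂ (Y x) y + ψ.form.baseChange ℂ x (Y y) = 0) :
    Y ∈ spanC 𝔤 := by
  have hΘ𝔥 : Θ ∈ spanC H.hodgeLie := (hodgeLieC_eq_spanC H) ▸ H.mem_hodgeLieC_of_forall_piece hΘ
  have hΘ𝔞 : Θ ∈ spanC (𝔤 ⊓ H.hodgeLie) := by rw [spanC_inf_eq]; exact ⟨hΘ𝔤, hΘ𝔥⟩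
  have hbr𝔞 : ∀ X ∈ 𝔤 ⊓ H.hodgeLie, ∀ X' ∈ 𝔤 ⊓ H.hodgeLie, X * X' - X' * X ∈ 𝔤 ⊓ H.hodgeLie :=
    fun X hX X' hX' => ⟨hbr X hX.1 X' hX'.1, H.commutator_mem_hodgeLie hX.2 hX'.2⟩
  have h𝔥le : H.hodgeLie ≤ 𝔤 ⊓ H.hodgeLie := hodgeLie_rigid H ⟨ψ⟩ (𝔤 ⊓ H.hodgeLie) inf_le_right hbr𝔞 ⟨Θ, hΘ𝔞, hΘ⟩
  have hY𝔥 : Y ∈ H.hodgeLieC := mem_hodgeLieC_of_skew_rankTen H hn heff ψ hE hV Y hY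
  rw [hodgeLieC_eq_spanC] at hY𝔥
  exact spanC_mono (h𝔥le.trans inf_le_left) hY𝔥

/-- **`𝔤_ℂ = 𝔰𝔭(V, ψ)_ℂ` as an equivalence** (rank ten). [cite: MoonenZarhin1999LowDim, §2 (2.3)] -/
theorem SymplecticThetaTen.mem_spanC_iff_skew (H : HodgeStructure V n) (hn : n = 1) (heff : H.IsEffective)
    (ψ : H.Polarization) (hE : ∀ a ∈ H.endAlg, ∃ x : ℚ, a = x • (1 : Module.End ℚ V)) (hV : Module.finrank ℚ V = 10)
    (𝔤 : Submodule ℚ (Module.End ℚ V)) (hbr : ∀ X ∈ 𝔤, ∀ X' ∈ 𝔤, X * X' - X' * X ∈ 𝔤)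
    {Θ : Module.End ℂ (ℂ ⊗[ℚ] V)} (hΘ : ∀ p, ∀ x ∈ H.piece p (n - p), Θ x = ((2 * p - n : ℤ) : ℂ) • x)
    (hΘ𝔤 : Θ ∈ spanC 𝔤) (hskew : ∀ X ∈ 𝔤, ∀ v w, ψ.form (X v) w + ψ.form v (X w) = 0)
    (Y : Module.End ℂ (ℂ ⊗[ℚ] V)) :
    Y ∈ spanC 𝔤 ↔ ∀ x y, ψ.form.baseChange ℂ (Y x) y + ψ.form.baseChange ℂ x (Y y) = 0 :=
  ⟨fun hY => ThetaSubalgebra.formBaseChange_add_eq_zero_of_mem_spanC ψ hskew hY,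
    fun hY => SymplecticThetaTen.mem_spanC_of_skew H hn heff ψ hE hV 𝔤 hbr hΘ hΘ𝔤 hskew hY⟩

end HodgeStructure

end Literature.AlgebraicGeometry.Motives
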